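import Summits.QuantumFields.BalabanUV.Beta.FP.ConstrainedBiLaplacianFibreSides

/-!
# `BalabanUV.Beta.FP.ConstrainedBiLaplacianKernel` — road «FP» for binder row D1, row **RHOA-4-GH (localisation half)** as re-worded by
# R-FP-29: FILE 3b of 3 — THE OFFSET-PAIR MULTIPLIERS OF THE CONSTRAINED INVERSE OF `(Δ^ξ)^s` ARE STRIP-REGULAR ON `Strip (d+1) (kappaB (d+1) s)`
# FOR EVERY `n ≥ 1`, HENCE THEIR LATTICE KERNELS DECAY LIKE `e^{−kappaB·|x⁰−y⁰|_∞}` ON THE BLOCK SCALE, WITH THE `n`-DEPENDENCE OF THE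
# PREFACTOR DISPLAYED (`((n:ℝ)^{d+1})⁻¹·4^{d+1}·(Lam n s + A + CG·SW²)`, `SW` n-uniform, `Lam` the located diagonal alias weight)

NOT IN PRINT; OUR PROOF ATTEMPT (binder row G-an2-4 ∕ (CONV-C), prover part P3, fibre∕strip lineage).  HONEST DEPENDENCY (cell records,
verbatim): «continuum YM on T⁴ ⇐ BetaPertH ∧ nine spine estimates (0/9 proved); BetaPertH ⇐ (D1) ∧ (D4) ∧ CAP+tail; G-an2-4 gates asym, D1
and NE2/3/4.»  HONEST FRAMING (cell contract, verbatim): «discharging `BetaPertH` makes Bałaban's UV stability UNCONDITIONAL — a real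
constructive-QFT result; it is NOT the continuum limit and NOT the Clay problem.»  ABSOLUTE RULE (cell charter, verbatim): «No internally-minted
statement may enter as a cited fact. Every hypothesis is either kernel-proved in this package or a verbatim quotation of a PUBLISHED theorem with
page reference. The manuscript(s) under audit are NOT citable for their own disputed steps — they are the thing under adjudication;
programme-internal (2001/route/tribunal) claims are never citable.»  THIS MODULE is [folklore] analysis over `B4StripSums`∕`B4ContourShift`
(`StripRegular`, `latticeKernel_decay`)∕`B5Strip145Analytic`∕`B5Strip145Decay` and FILES 1, 2a, 2b, 3a of this row; it re-defines no symbol, cites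
nothing as a hypothesis, has no `def … : Prop` and no `sorry`.

## The statement (dictionary in the header of FILE 2a; every `d`, every `n ≥ 1`, every order `s`)

For fine points `x = x⁰ + ξτ`, `y = y⁰ + ξσ` (`x⁰, y⁰ ∈ ℤ^{d+1}`, offsets `τ, σ ∈ {0,…,n−1}^{d+1}`, `ξ = 1∕n`) the kernel of the inverse of
`A = (Δ^ξ)^s` compressed to `ker Q′` (Sherman–Morrison in the alias fibre, FILE 2a §0) is `latticeKernel (M n s τ σ) (x⁰ − y⁰)` with the
OFFSET-PAIR MULTIPLIER `M n s τ σ p′ = ((n:ℂ)^{d+1})⁻¹ Σ_{k,k′} EF(τ,k) · EFc(σ,k′) · Gfib n s k k′ p′` (sub-lattice phases `e^{±i(p′+l)·ξτ}` times the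
regrouped fibre entries of FILE 2b).  THIS FILE PROVES: `M n s τ σ` is `StripRegular` on `Strip (d+1) (kappaB (d+1) s)` with the bound
`boundM n (d+1) s = ((n:ℝ)^{d+1})⁻¹·4^{d+1}·(Lam n (d+1) s + CG·(SW n (d+1) s)² + 132^{d+1}(64∕7)^s∕cB)` (`stripRegular_M`), hence
**`kernel_decay : ‖latticeKernel (M n s τ σ) x‖ ≤ boundM n (d+1) s · e^{−kappaB (d+1) s·|x|_∞}`** for every `x ∈ ℤ^{d+1}`, `n ≥ 1`, `τ, σ` — the
scale-n exponential localisation by the FIBRE∕STRIP ROUTE with the n-FREE rate `kappaB` of FILE 1.  THE PREFACTOR, HONESTLY: `SW n d s = Σ_k wt n s k`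
IS n-uniform (`SW_le`: `≤ (64∕7)^s(48ζ_{d+1})^{d+1}`, `s ≥ 1`), while the DIAGONAL alias weight `Lam n d s = Σ_{k≠0}((64∕7)∕W_k)^s` is an explicit
finite sum that is NOT n-uniform at `(s, d+1) = (2, 4)` (it is the located `log n` — the coincident-point variance of the 4-D membrane model; it IS
n-uniform for `2s > d+1`); in unit-lattice currency (`× n^{2s}`) the bound reads `C(n)·e^{−kappaB|x⁰−y⁰|_∞}` with `C(n) = n^{2s−(d+1)}4^{d+1}(Lam n (d+1) s + …)`.
The n-UNIFORM statement for the ghost (`s = 2`, `d+1 = 4`) is the block-pair OPERATOR norm (alias-operator norm of `Gfib` n-uniform) — NOT in this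
file (it needs the matrix-coefficient form of the contour shift); said so that no consumer over-reads `kernel_decay`.

v1.1 (gen 22, DOCSTRING-ONLY — no declaration changed): module docstring `boundM n d s` → `boundM n (d+1) s` (NIT-1 of the cross-read
C-gan24leaf03-g46, matching the theorem `kernel_decay`), and a size-of-constants sentence on `kernel_decay_uniform` (INFO-1∕2 ibid.).

## Contents

* §1 the sub-lattice phases `EF`∕`EFc` (products of `ef`∕`efc`): norms `≤ 2^{·}`, differentiability, `EF_tr`∕`EFc_tr`.
* §2 `M`, `differentiableAt_M`, **`M_tr_side`** (side periodicity from FILE 3a's `Gfib_tr_side` + reindexing by `sigmaEquiv × sigmaEquiv`).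
* §3 `Lam`, `SW`, `SW_le`, `boundM`, `bnd` (entrywise majorant of `Gfib`), **`norm_M_le`**.
* §4 **`stripRegular_M`**, **`kernel_decay`**, `kernel_decay_uniform` (the packaged `∀ n ≥ 1` form).

0∕4 row-D1 binders touched.  NOT RHOA-4-GH as the consumer will read it (B-jets ∕ background dependence and the torus periodisation are not here;
the operator-norm prefactor is not here), NOT hbook, NOT D1, NOT BetaPertH, NOT continuum, NOT Clay.  Provenance: prover-b2b-balaban-gan24-p3-g21-0
(unit `b2b-balaban-gan24-p3`, gen 21; R-FP-29 first refusal; R-FP-33 (b) «in-flight work finishes»), 2026-08-21.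
-/

noncomputable section

namespace Summit.QuantumFields.BalabanUV.Beta.FP.ConstrainedBiLaplacianKernel

open Complex Finset
open Literature.MathematicalPhysics.QuantumFieldTheory.Balaban1983to89
open Literature.MathematicalPhysics.QuantumFieldTheory.Balaban1983to89.B4Strip
open Literature.MathematicalPhysics.QuantumFieldTheory.Balaban1983to89.B4StripCauchy
open Literature.MathematicalPhysics.QuantumFieldTheory.Balaban1983to89.B5Strip145Analytic
open Literature.MathematicalPhysics.QuantumFieldTheory.Balaban1983to89.B5Strip145Decay
open Literature.MathematicalPhysics.QuantumFieldTheory.Balaban1983to89.B4StripSums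
open Literature.MathematicalPhysics.QuantumFieldTheory.Balaban1983to89.B4ContourShift
open Summit.QuantumFields.BalabanUV.Beta.FP.ConstrainedBiLaplacianStrip
open Summit.QuantumFields.BalabanUV.Beta.FP.ConstrainedBiLaplacianFibre
open Summit.QuantumFields.BalabanUV.Beta.FP.ConstrainedBiLaplacianFibreEntries
open Summit.QuantumFields.BalabanUV.Beta.FP.ConstrainedBiLaplacianFibreSides
open scoped Real

variable {d : ℕ}

/-! ## §1 The sub-lattice phases -/

/-- [folklore] `EF n τ k p = Π_ν e^{i(p_ν+2πk_ν)τ_ν∕n}` — the phase `e^{i(p′+l)·ξτ}` of the fine point `x⁰ + ξτ`. -/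
def EF (n : ℕ) (τ k : Fin d → Fin n) (p : Fin d → ℂ) : ℂ := ∏ ν, ef n (k ν : ℕ) (τ ν : ℕ) (p ν)

/-- [folklore] `EFc n σ k p = Π_ν e^{−i(p_ν+2πk_ν)σ_ν∕n}` — the conjugate phase of the fine point `y⁰ + ξσ`. -/
def EFc (n : ℕ) (σ k : Fin d → Fin n) (p : Fin d → ℂ) : ℂ := ∏ ν, efc n (k ν : ℕ) (σ ν : ℕ) (p ν)

/-- [folklore] `‖EF‖ ≤ 2^d` on the fat region (`r ≤ 1∕4`). -/
theorem norm_EF_le (n : ℕ) [NeZero n] {r : ℝ} (hr : r ≤ 1 / 4) (τ k : Fin d → Fin n) {p : Fin d → ℂ} (hp : p ∈ Fat d r) :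
    ‖EF n τ k p‖ ≤ 2 ^ d := by
  unfold EF
  rw [norm_prod]
  calc ∏ ν, ‖ef n (k ν : ℕ) (τ ν : ℕ) (p ν)‖ ≤ ∏ _ν : Fin d, (2 : ℝ) :=
        Finset.prod_le_prod (fun _ _ => norm_nonneg _)
          (fun ν _ => norm_ef_le n (k ν) (τ ν) (τ ν).isLt.le (by linarith [(hp ν).2]))
    _ = 2 ^ d := by simp

/-- [folklore] `‖EFc‖ ≤ 2^d` on the fat region (`r ≤ 1∕4`). -/
theorem norm_EFc_le (n : ℕ) [NeZero n] {r : ℝ} (hr : r ≤ 1 / 4) (σ k : Fin d → Fin n) {p : Fin d → ℂ} (hp : p ∈ Fat d r) :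
    ‖EFc n σ k p‖ ≤ 2 ^ d := by
  unfold EFc
  rw [norm_prod]
  calc ∏ ν, ‖efc n (k ν : ℕ) (σ ν : ℕ) (p ν)‖ ≤ ∏ _ν : Fin d, (2 : ℝ) :=
        Finset.prod_le_prod (fun _ _ => norm_nonneg _)
          (fun ν _ => norm_efc_le n (k ν) (σ ν) (σ ν).isLt.le (by linarith [(hp ν).2]))
    _ = 2 ^ d := by simp

/-- [folklore] `EF n τ k` is entire (jointly). -/
theorem differentiableAt_EF (n : ℕ) (τ k : Fin d → Fin n) (q : Fin d → ℂ) : DifferentiableAt ℂ (EF n τ k) q := by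
  unfold EF
  apply dAt_finset_prod
  intro ν _
  exact DifferentiableAt.comp (g := ef n (k ν) (τ ν)) (f := fun p : Fin d → ℂ => p ν) q
    ((differentiable_ef n (k ν) (τ ν)) (q ν)) (differentiableAt_apply (𝕜 := ℂ) ν q)

/-- [folklore] `EFc n σ k` is entire (jointly). -/
theorem differentiableAt_EFc (n : ℕ) (σ k : Fin d → Fin n) (q : Fin d → ℂ) : DifferentiableAt ℂ (EFc n σ k) q := by
  unfold EFc
  apply dAt_finset_prod
  intro ν _
  exact DifferentiableAt.comp (g := efc n (k ν) (σ ν)) (f := fun p : Fin d → ℂ => p ν) q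
    ((differentiable_efc n (k ν) (σ ν)) (q ν)) (differentiableAt_apply (𝕜 := ℂ) ν q)

/-- [folklore] `EF n τ k (p + 2πe_μ) = EF n τ (σ_μ k) p`. -/
theorem EF_tr (n : ℕ) [NeZero n] (τ k : Fin d → Fin n) (p : Fin d → ℂ) (μ : Fin d) : EF n τ k (tr p μ) = EF n τ (sigma n μ k) p := by
  unfold EF
  refine Finset.prod_congr rfl (fun ν _ => ?_)
  by_cases h : ν = μ
  · subst h
    rw [tr_apply_self, sigma_apply_self, val_add_one_eq_mod, ef_add_two_pi _ _ _ (NeZero.ne n)]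
  · rw [tr_apply_of_ne h, sigma_apply_of_ne n h]

/-- [folklore] `EFc n σ k (p + 2πe_μ) = EFc n σ (σ_μ k) p`. -/
theorem EFc_tr (n : ℕ) [NeZero n] (σ k : Fin d → Fin n) (p : Fin d → ℂ) (μ : Fin d) : EFc n σ k (tr p μ) = EFc n σ (sigma n μ k) p := by
  unfold EFc
  refine Finset.prod_congr rfl (fun ν _ => ?_)
  by_cases h : ν = μ
  · subst h
    rw [tr_apply_self, sigma_apply_self, val_add_one_eq_mod, efc_add_two_pi _ _ _ (NeZero.ne n)]
  · rw [tr_apply_of_ne h, sigma_apply_of_ne n h]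

/-! ## §2 The offset-pair multiplier -/

/-- [folklore] **THE OFFSET-PAIR MULTIPLIER** of the constrained inverse of `(Δ^ξ)^s` between the fine offsets `τ` (left) and `σ` (right):
`M n s τ σ p′ = ((n:ℂ)^d)⁻¹ Σ_{k,k′} EF(τ,k)·EFc(σ,k′)·Gfib n s k k′ p′` — so that the fine-lattice kernel entry `((x⁰,τ),(y⁰,σ))` is
`latticeKernel (M n s τ σ) (x⁰ − y⁰)` (dictionary: FILE 2a header and §0). -/
def M (n : ℕ) [NeZero n] (s : ℕ) (τ σ : Fin d → Fin n) (p : Fin d → ℂ) : ℂ :=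
  ((n : ℂ) ^ d)⁻¹ * ∑ k : Fin d → Fin n, ∑ k' : Fin d → Fin n, EF n τ k p * EFc n σ k' p * Gfib n s k k' p

/-- [folklore] `M n s τ σ` is holomorphic (jointly) at every point of the strip `Strip d (kappaB d s)`. -/
theorem differentiableAt_M (n : ℕ) [NeZero n] (s : ℕ) (τ σ : Fin d → Fin n) {p : Fin d → ℂ} (hp : p ∈ Strip d (kappaB d s)) :
    DifferentiableAt ℂ (M n s τ σ) p := by
  show DifferentiableAt ℂ (fun q => ((n : ℂ) ^ d)⁻¹ * ∑ k : Fin d → Fin n, ∑ k' : Fin d → Fin n,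
    EF n τ k q * EFc n σ k' q * Gfib n s k k' q) p
  apply DifferentiableAt.const_mul
  apply DifferentiableAt.fun_sum; intro k _
  apply DifferentiableAt.fun_sum; intro k' _
  exact ((differentiableAt_EF n τ k p).mul (differentiableAt_EFc n σ k' p)).mul (differentiableAt_Gfib n s k k' hp)

/-- [folklore] **SIDE PERIODICITY OF THE MULTIPLIER**: `M n s τ σ (p + 2πe_μ) = M n s τ σ p` at every strip point `p ∈ Strip d κ` (`0 ≤ κ ≤ kappaB d s`)
with `Re p_μ = −π` (relabel both alias sums by `σ_μ`: `EF_tr`, `EFc_tr`, FILE 3a's `Gfib_tr_side`). -/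
theorem M_tr_side (n : ℕ) [NeZero n] (s : ℕ) {κ : ℝ} (hκ0 : 0 ≤ κ) (hκ : κ ≤ kappaB d s) {p : Fin d → ℂ} (hp : p ∈ Strip d κ)
    (μ : Fin d) (hre : (p μ).re = -Real.pi) (τ σ : Fin d → Fin n) : M n s τ σ (tr p μ) = M n s τ σ p := by
  unfold M
  congr 1
  calc ∑ k : Fin d → Fin n, ∑ k' : Fin d → Fin n, EF n τ k (tr p μ) * EFc n σ k' (tr p μ) * Gfib n s k k' (tr p μ)
      = ∑ k : Fin d → Fin n, ∑ k' : Fin d → Fin n,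
          EF n τ (sigma n μ k) p * EFc n σ (sigma n μ k') p * Gfib n s (sigma n μ k) (sigma n μ k') p := by
        refine Finset.sum_congr rfl fun k _ => Finset.sum_congr rfl fun k' _ => ?_
        rw [EF_tr, EFc_tr, Gfib_tr_side n s hκ0 hκ hp μ hre]
    _ = ∑ k : Fin d → Fin n, ∑ k' : Fin d → Fin n, EF n τ k p * EFc n σ (sigma n μ k') p * Gfib n s k (sigma n μ k') p :=
        Equiv.sum_comp (sigmaEquiv n μ)
          (fun k => ∑ k' : Fin d → Fin n, EF n τ k p * EFc n σ (sigma n μ k') p * Gfib n s k (sigma n μ k') p)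
    _ = ∑ k : Fin d → Fin n, ∑ k' : Fin d → Fin n, EF n τ k p * EFc n σ k' p * Gfib n s k k' p :=
        Finset.sum_congr rfl fun k _ =>
          Equiv.sum_comp (sigmaEquiv n μ) (fun k' => EF n τ k p * EFc n σ k' p * Gfib n s k k' p)

/-! ## §3 The bound on the strip -/

/-- [folklore] **THE DIAGONAL ALIAS WEIGHT** `Lam n s = Σ_{k≠0}((64∕7)∕W_n(k))^s` — an explicit finite sum; NOT n-uniform at `(s, d) = (2, 4)` (the
located `log n`), n-uniform for `2s > d`. -/
def Lam (n : ℕ) [NeZero n] (d s : ℕ) : ℝ := ∑ k ∈ Finset.univ.erase (fun _ : Fin d => (0 : Fin n)), ((64 / 7) / W n k) ^ s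

/-- [folklore] `0 ≤ Lam`. -/
theorem Lam_nonneg (n : ℕ) [NeZero n] (d s : ℕ) : 0 ≤ Lam n d s := by
  unfold Lam
  refine Finset.sum_nonneg fun k hk => ?_
  have := one_le_W n k (Finset.ne_of_mem_erase hk)
  positivity

/-- [folklore] **THE SUMMED RANK-ONE WEIGHT** `SW n s = Σ_k wt n s k`. -/
def SW (n : ℕ) [NeZero n] (d s : ℕ) : ℝ := ∑ k : Fin d → Fin n, wt n s k

/-- [folklore] `0 ≤ SW`. -/
theorem SW_nonneg (n : ℕ) [NeZero n] (d s : ℕ) : 0 ≤ SW n d s :=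
  Finset.sum_nonneg fun k _ => wt_nonneg n s k

/-- [folklore] Every weight is dominated by the summable profile: `wt n s k ≤ (64∕7)^s · Π_ν 24·ω_n(k_ν)^{−(1+2∕d)}` (`s ≥ 1`, `0 < d`; at `k ≠ 0` the
gain `W_k^{−1} ≤ Π_ν ω^{−2∕d}` of `B4StripSums.inv_W_le_prod_rpow`, at `k = 0` all `ω = 1`). -/
theorem wt_le_profile (n : ℕ) [NeZero n] (hd : 0 < d) {s : ℕ} (hs : 1 ≤ s) (k : Fin d → Fin n) :
    wt n s k ≤ (64 / 7) ^ s * ∏ ν, 24 * omega n (k ν) ^ (-(1 + 2 / (d : ℝ))) := by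
  have hn : 1 ≤ n := Nat.one_le_iff_ne_zero.mpr (NeZero.ne n)
  have hω : ∀ ν, 0 < omega n (k ν) := fun ν => omega_pos n (k ν) (k ν).isLt
  have hsplit : ∀ ν, 24 * omega n (k ν) ^ (-(1 + 2 / (d : ℝ))) = (24 / omega n (k ν)) * omega n (k ν) ^ (-(2 : ℝ) / d) := by
    intro ν
    have h1 : -(1 + 2 / (d : ℝ)) = (-1 : ℝ) + (-(2 : ℝ) / d) := by ring
    rw [h1, Real.rpow_add (hω ν), Real.rpow_neg_one]
    ring
  simp_rw [hsplit]
  rw [Finset.prod_mul_distrib]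
  unfold wt sideWt
  have hP : 0 ≤ ∏ ν, 12 / omega n (k ν) := Finset.prod_nonneg fun ν _ => by have := hω ν; positivity
  have hP12 : ∏ ν, 12 / omega n (k ν) ≤ ∏ ν, 24 / omega n (k ν) :=
    Finset.prod_le_prod (fun ν _ => by have := hω ν; positivity) (fun ν _ => by
      have := hω ν; rw [div_le_div_iff_of_pos_right this]; norm_num)
  have h64 : (1 : ℝ) ≤ (64 / 7) ^ s := one_le_pow₀ (by norm_num)
  split_ifs with hk
  · -- k = 0: all residues vanish, ω = 1
    have hω1 : ∀ ν, omega n (k ν) = 1 := fun ν => by rw [hk]; exact omega_zero n hn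
    simp only [hω1, Real.one_rpow, Finset.prod_const_one, mul_one, div_one]
    simp only [hω1, div_one] at hP12 hP
    calc (∏ _ν : Fin d, (12 : ℝ)) ≤ ∏ _ν : Fin d, (24 : ℝ) := hP12
      _ ≤ (64 / 7) ^ s * ∏ _ν : Fin d, (24 : ℝ) := le_mul_of_one_le_left (Finset.prod_nonneg fun _ _ => by norm_num) h64
  · have hW := one_le_W n k hk
    have hWs : ((64 / 7 : ℝ) / W n k) ^ s ≤ (64 / 7) ^ s * (1 / W n k) := by
      rw [div_pow]
      have hW1 : W n k ≤ W n k ^ s := le_self_pow₀ hW (by omega)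
      rw [div_le_iff₀ (by positivity)]
      calc (64 / 7 : ℝ) ^ s = (64 / 7) ^ s * (1 / W n k) * W n k := by field_simp
        _ ≤ (64 / 7) ^ s * (1 / W n k) * W n k ^ s := mul_le_mul_of_nonneg_left hW1 (by positivity)
    have hrp := inv_W_le_prod_rpow n hd k hk
    have hR : 0 ≤ ∏ ν, omega n (k ν) ^ (-(2 : ℝ) / d) := Finset.prod_nonneg fun ν _ => Real.rpow_nonneg (hω ν).le _
    calc (∏ ν, 12 / omega n (k ν)) * ((64 / 7) / W n k) ^ s
        ≤ (∏ ν, 24 / omega n (k ν)) * ((64 / 7) ^ s * (1 / W n k)) := mul_le_mul hP12 hWs (by positivity) (hP.trans hP12)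
      _ ≤ (∏ ν, 24 / omega n (k ν)) * ((64 / 7) ^ s * ∏ ν, omega n (k ν) ^ (-(2 : ℝ) / d)) :=
          mul_le_mul_of_nonneg_left (mul_le_mul_of_nonneg_left hrp (by positivity)) (hP.trans hP12)
      _ = (64 / 7) ^ s * ((∏ ν, 24 / omega n (k ν)) * ∏ ν, omega n (k ν) ^ (-(2 : ℝ) / d)) := by ring

/-- [folklore] **`SW` IS n-UNIFORM**: `SW n s ≤ (64∕7)^s·(48 ζ_d)^d` for every `n ≥ 1` (`s ≥ 1`, `0 < d`; `B4StripSums.sum_prod_le`). -/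
theorem SW_le (n : ℕ) [NeZero n] (hd : 0 < d) {s : ℕ} (hs : 1 ≤ s) : SW n d s ≤ (64 / 7) ^ s * (48 * zetaC d) ^ d := by
  unfold SW
  calc ∑ k : Fin d → Fin n, wt n s k ≤ ∑ k : Fin d → Fin n, (64 / 7) ^ s * ∏ ν, 24 * omega n (k ν) ^ (-(1 + 2 / (d : ℝ))) :=
        Finset.sum_le_sum fun k _ => wt_le_profile n hd hs k
    _ = (64 / 7) ^ s * ∑ k : Fin d → Fin n, ∏ ν, 24 * omega n (k ν) ^ (-(1 + 2 / (d : ℝ))) := by rw [Finset.mul_sum]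
    _ ≤ (64 / 7) ^ s * (48 * zetaC d) ^ d := mul_le_mul_of_nonneg_left (sum_prod_le n hd) (by positivity)

/-- [folklore] The entrywise majorant of the fibre entries on the strip (FILE 2b's two bounds in one function). -/
def bnd (n : ℕ) [NeZero n] (d s : ℕ) (k k' : Fin d → Fin n) : ℝ :=
  (if k = k' ∧ k ≠ (fun _ => (0 : Fin n)) then ((64 / 7) / W n k) ^ s else 0) + CG d s * wt n s k * wt n s k' +
    (if k = (fun _ => (0 : Fin n)) ∧ k' = (fun _ => (0 : Fin n)) then 132 ^ d * (64 / 7) ^ s / cB d else 0)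

/-- [folklore] `‖Gfib n s k k′ p‖ ≤ bnd n d s k k′` on the strip, all `k, k′`. -/
theorem norm_Gfib_le_bnd (n : ℕ) [NeZero n] (s : ℕ) (k k' : Fin d → Fin n) {p : Fin d → ℂ} (hp : p ∈ Strip d (kappaB d s)) :
    ‖Gfib n s k k' p‖ ≤ bnd n d s k k' := by
  unfold bnd
  have hwt : 0 ≤ CG d s * wt n s k * wt n s k' := mul_nonneg (mul_nonneg (CG_nonneg d s) (wt_nonneg n s k)) (wt_nonneg n s k')
  by_cases hkk : k = (fun _ => (0 : Fin n)) ∧ k' = (fun _ => (0 : Fin n))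
  · obtain ⟨h1, h2⟩ := hkk
    subst h1; subst h2
    rw [if_neg (fun h => h.2 rfl), if_pos ⟨rfl, rfl⟩, zero_add]
    have := norm_Gfib_zero_zero_le n s hp
    linarith
  · rw [if_neg hkk, add_zero]
    exact norm_Gfib_le n s k k' hkk hp

/-- [folklore] `Σ_{k,k′} bnd = Lam + CG·SW² + 132^d(64∕7)^s∕cB`. -/
theorem sum_bnd_eq (n : ℕ) [NeZero n] (s : ℕ) :
    ∑ k : Fin d → Fin n, ∑ k' : Fin d → Fin n, bnd n d s k k' = Lam n d s + CG d s * SW n d s ^ 2 + 132 ^ d * (64 / 7) ^ s / cB d := by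
  unfold bnd Lam SW
  simp only [Finset.sum_add_distrib]
  have h1 : ∑ k : Fin d → Fin n, ∑ k' : Fin d → Fin n,
      (if k = k' ∧ k ≠ (fun _ => (0 : Fin n)) then ((64 / 7 : ℝ) / W n k) ^ s else 0)
      = ∑ k ∈ Finset.univ.erase (fun _ : Fin d => (0 : Fin n)), ((64 / 7 : ℝ) / W n k) ^ s := by
    rw [← Finset.sum_erase_add Finset.univ _ (Finset.mem_univ (fun _ : Fin d => (0 : Fin n)))]
    have hz : ∑ k' : Fin d → Fin n, (if (fun _ : Fin d => (0 : Fin n)) = k' ∧ (fun _ : Fin d => (0 : Fin n)) ≠ (fun _ : Fin d => (0 : Fin n))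
        then ((64 / 7 : ℝ) / W n (fun _ : Fin d => (0 : Fin n))) ^ s else (0 : ℝ)) = 0 :=
      Finset.sum_eq_zero fun k' _ => if_neg (fun h => h.2 rfl)
    rw [hz, add_zero]
    refine Finset.sum_congr rfl fun k hk => ?_
    have hk0 : k ≠ fun _ => (0 : Fin n) := Finset.ne_of_mem_erase hk
    have : ∀ k' : Fin d → Fin n, (if k = k' ∧ k ≠ (fun _ => (0 : Fin n)) then ((64 / 7 : ℝ) / W n k) ^ s else 0)
        = if k = k' then ((64 / 7 : ℝ) / W n k) ^ s else 0 := fun k' => by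
      by_cases h : k = k'
      · rw [if_pos ⟨h, hk0⟩, if_pos h]
      · rw [if_neg (fun h' => h h'.1), if_neg h]
    simp only [this, Finset.sum_ite_eq, Finset.mem_univ, if_true]
  have h2 : ∑ k : Fin d → Fin n, ∑ k' : Fin d → Fin n, CG d s * wt n s k * wt n s k'
      = CG d s * (∑ k : Fin d → Fin n, wt n s k) ^ 2 := by
    rw [sq, Finset.sum_mul_sum, Finset.mul_sum]
    refine Finset.sum_congr rfl fun k _ => ?_
    rw [Finset.mul_sum]
    refine Finset.sum_congr rfl fun k' _ => ?_
    ring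
  have h3 : ∑ k : Fin d → Fin n, ∑ k' : Fin d → Fin n,
      (if k = (fun _ => (0 : Fin n)) ∧ k' = (fun _ => (0 : Fin n)) then (132 : ℝ) ^ d * (64 / 7) ^ s / cB d else 0)
      = 132 ^ d * (64 / 7) ^ s / cB d := by
    have : ∀ k k' : Fin d → Fin n, (if k = (fun _ => (0 : Fin n)) ∧ k' = (fun _ => (0 : Fin n)) then (132 : ℝ) ^ d * (64 / 7) ^ s / cB d else 0)
        = if k' = (fun _ => (0 : Fin n)) then (if k = (fun _ => (0 : Fin n)) then (132 : ℝ) ^ d * (64 / 7) ^ s / cB d else 0) else 0 :=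
      fun k k' => by split_ifs <;> simp_all
    simp only [this, Finset.sum_ite_eq', Finset.mem_univ, if_true]
  rw [h1, h2, h3]

/-- [folklore] **THE BOUND OF THE MULTIPLIER ON THE STRIP**, with the n-dependence displayed:
`boundM n d s = ((n:ℝ)^d)⁻¹·4^d·(Lam n d s + CG d s·(SW n d s)² + 132^d(64∕7)^s∕cB d)`. -/
def boundM (n : ℕ) [NeZero n] (d s : ℕ) : ℝ :=
  ((n : ℝ) ^ d)⁻¹ * 4 ^ d * (Lam n d s + CG d s * SW n d s ^ 2 + 132 ^ d * (64 / 7) ^ s / cB d)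

/-- [folklore] `0 ≤ boundM`. -/
theorem boundM_nonneg (n : ℕ) [NeZero n] (d s : ℕ) : 0 ≤ boundM n d s := by
  unfold boundM
  have := Lam_nonneg n d s
  have := CG_nonneg d s
  have := cB_pos d
  positivity

/-- [folklore] **`‖M n s τ σ p‖ ≤ boundM n d s` ON THE STRIP `Strip d (kappaB d s)`**, every `n ≥ 1`, `τ`, `σ`. -/
theorem norm_M_le (n : ℕ) [NeZero n] (s : ℕ) (τ σ : Fin d → Fin n) {p : Fin d → ℂ} (hp : p ∈ Strip d (kappaB d s)) :
    ‖M n s τ σ p‖ ≤ boundM n d s := by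
  have hfat : p ∈ Fat d (rOf d) := strip_subset_fat (rOf_pos d).le (kappaB_le_rOf d s) hp
  have hn : (0 : ℝ) < (n : ℝ) ^ d := by
    have : (0 : ℝ) < n := by exact_mod_cast Nat.pos_of_ne_zero (NeZero.ne n)
    positivity
  have hterm : ∀ k k' : Fin d → Fin n, ‖EF n τ k p * EFc n σ k' p * Gfib n s k k' p‖ ≤ 4 ^ d * bnd n d s k k' := by
    intro k k'
    rw [norm_mul, norm_mul]
    have h1 := norm_EF_le n (rOf_le d) τ k hfat
    have h2 := norm_EFc_le n (rOf_le d) σ k' hfat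
    have h3 := norm_Gfib_le_bnd n s k k' hp
    have h4 : (4 : ℝ) ^ d = 2 ^ d * 2 ^ d := by rw [← mul_pow]; norm_num
    rw [h4]
    exact mul_le_mul (mul_le_mul h1 h2 (norm_nonneg _) (by positivity)) h3 (norm_nonneg _) (by positivity)
  unfold M boundM
  rw [norm_mul, norm_inv, norm_pow, Complex.norm_natCast, mul_assoc]
  refine mul_le_mul_of_nonneg_left ?_ (by positivity)
  calc ‖∑ k : Fin d → Fin n, ∑ k' : Fin d → Fin n, EF n τ k p * EFc n σ k' p * Gfib n s k k' p‖
      ≤ ∑ k : Fin d → Fin n, ‖∑ k' : Fin d → Fin n, EF n τ k p * EFc n σ k' p * Gfib n s k k' p‖ := norm_sum_le _ _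
    _ ≤ ∑ k : Fin d → Fin n, ∑ k' : Fin d → Fin n, ‖EF n τ k p * EFc n σ k' p * Gfib n s k k' p‖ :=
        Finset.sum_le_sum fun k _ => norm_sum_le _ _
    _ ≤ ∑ k : Fin d → Fin n, ∑ k' : Fin d → Fin n, 4 ^ d * bnd n d s k k' :=
        Finset.sum_le_sum fun k _ => Finset.sum_le_sum fun k' _ => hterm k k'
    _ = 4 ^ d * (Lam n d s + CG d s * SW n d s ^ 2 + 132 ^ d * (64 / 7) ^ s / cB d) := by
        rw [← sum_bnd_eq n s]
        simp only [Finset.mul_sum]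

/-! ## §4 Strip regularity and the exponential decay of the kernel -/

/-- [folklore] **STRIP REGULARITY OF THE OFFSET-PAIR MULTIPLIERS** (`B4ContourShift.StripRegular`, dimension `d+1`): for EVERY `n ≥ 1`, every order
`s` and all offsets `τ, σ`, `M n s τ σ` is continuous on `Strip (d+1) (kappaB (d+1) s)`, holomorphic in each coordinate, periodic across the sides,
and bounded by `boundM n (d+1) s`. -/
theorem stripRegular_M (n : ℕ) [NeZero n] (s : ℕ) (τ σ : Fin (d + 1) → Fin n) :
    StripRegular (d := d) (M n s τ σ) (kappaB (d + 1) s) (boundM n (d + 1) s) := by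
  have hκ0 : 0 ≤ kappaB (d + 1) s := (kappaB_pos (d + 1) s).le
  have hdiffAt : ∀ p ∈ Strip (d + 1) (kappaB (d + 1) s), DifferentiableAt ℂ (M n s τ σ) p := fun p hp => differentiableAt_M n s τ σ hp
  refine ⟨?_, ?_, ?_, ?_⟩
  · exact fun p hp => (hdiffAt p hp).continuousAt.continuousWithinAt
  · intro i q hq z hz
    have hP : i.insertNth z (ofRealVec q) ∈ Strip (d + 1) (kappaB (d + 1) s) :=
      insertNth_mem_Strip hκ0 i hq (openRect_subset_closedRect _ hz)
    exact ((hdiffAt _ hP).comp z (differentiableAt_insertNth i _ z)).differentiableWithinAt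
  · intro i q hq y hy
    obtain ⟨hP, hre⟩ := insertNth_left_mem hκ0 i hq hy
    rw [← tr_insertNth_left]
    exact (M_tr_side n s hκ0 le_rfl hP i hre τ σ).symm
  · intro p hp
    exact norm_M_le n s τ σ hp

/-- [folklore] **THE SCALE-n EXPONENTIAL LOCALISATION OF THE CONSTRAINED INVERSE OF `(Δ^ξ)^s`, FIBRE∕STRIP ROUTE** (R-FP-29's second arrow at
U = 𝟙, infinite lattice `ℤ^{d+1}` tiled by n-blocks): for EVERY `n ≥ 1`, every order `s`, all offsets `τ, σ ∈ {0,…,n−1}^{d+1}` and every block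
separation `x ∈ ℤ^{d+1}`,  `‖latticeKernel (M n s τ σ) x‖ ≤ boundM n (d+1) s · e^{−kappaB (d+1) s · |x|_∞}` — rate `kappaB` EXPLICIT and n-FREE
(FILE 1), prefactor `boundM` with its n-dependence DISPLAYED (§3; `SW` n-uniform by `SW_le`, `Lam` the located diagonal alias weight). -/
theorem kernel_decay (n : ℕ) [NeZero n] (s : ℕ) (τ σ : Fin (d + 1) → Fin n) (x : Fin (d + 1) → ℤ) :
    ‖latticeKernel (M n s τ σ) x‖ ≤ boundM n (d + 1) s * Real.exp (-(kappaB (d + 1) s * supNorm x)) :=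
  latticeKernel_decay (stripRegular_M n s τ σ) (kappaB_pos (d + 1) s).le x

/-- [folklore] The packaged form: ONE rate `κ > 0` (n-free) and, for each `n ≥ 1`, the displayed prefactor, for all offsets and separations.
SIZE OF THE CONSTANTS (v1.1 note, cross-read C-gan24leaf03-g46 INFO-1∕2): `κ = kappaB (d+1) s` and `boundM` are QUALITATIVE — at
`(d+1, s) = (4, 2)` the explicit `kappaB ≈ 10⁻¹⁸` per block and `boundM`'s n-free part is astronomically large, against an empirical mass
`≈ 1` per block; consumers needing `∃ κ > 0, ∃ C` are served, consumers needing NUMBERS are not (a certified constant is balaban-calc business). -/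
theorem kernel_decay_uniform (d s : ℕ) :
    ∃ κ : ℝ, 0 < κ ∧ ∀ (n : ℕ) [NeZero n] (τ σ : Fin (d + 1) → Fin n) (x : Fin (d + 1) → ℤ),
      ‖latticeKernel (M n s τ σ) x‖ ≤ boundM n (d + 1) s * Real.exp (-(κ * supNorm x)) :=
  ⟨kappaB (d + 1) s, kappaB_pos (d + 1) s, fun n _ τ σ x => kernel_decay n s τ σ x⟩

end Summit.QuantumFields.BalabanUV.Beta.FP.ConstrainedBiLaplacianKernel

end
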